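import Mathlib.MeasureTheory.Function.LpSpace.ContinuousCompMeasurePreserving
import Mathlib.MeasureTheory.Function.L2Space
import Mathlib.MeasureTheory.Group.Action
import Mathlib.Analysis.InnerProductSpace.Adjoint
import Mathlib.Topology.Algebra.MulAction

/-!
# T5RegularRep — the regular representation on `L²` of a measure-preserving action is a strongly
continuous unitary representation

Cell pub-hodge-repro2, seat p5, Tier 5 (route/T5-N4-p5.md, N4.3 (A3) STEP 1, l. 147): «Let
G := U(W_A), L := L²(G(F)\G(𝔸)) with the right regular unitary representation R of the locally
compact group G(𝔸) ([Bo72] 5.1 …)».  The annex rows 12 / 15 left «the unitarity and strong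
continuity of the right regular representation on L²([U(W_A)])» in prose; this file is the general
kernel statement behind it, for ANY group `G` acting on a measure space `(X, μ)` by
measure-preserving maps (`SMulInvariantMeasure G X μ`, measurable action): the operators
`ρ g f := f ∘ (g⁻¹ • ·)` on `Lp ℂ 2 μ`

* form a representation `regularRep μ : G →* (Lp ℂ 2 μ →L[ℂ] Lp ℂ 2 μ)` (Mathlib's
  `Lp.compMeasurePreservingₗᵢ`);
* are unitary in the convention of the p5 Schur files, `star (regularRep μ g) = regularRep μ g⁻¹`
  (`star_regularRep`), because each `ρ g` is a linear isometry with inverse `ρ g⁻¹`;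
* are strongly continuous, `Continuous fun g => regularRep μ g f` (`continuous_regularRep_apply`),
  when `G` is a topological group acting continuously on an R₁ Borel space `X` with `μ` inner regular
  for finite-measure sets (Mathlib `Lp.compMeasurePreserving_continuous`, joint continuity in the
  function and the measure-preserving map in the compact-open topology).

Reading: with `X = G(F)\G(𝔸)` and the right action of `G(𝔸)`, `regularRep` is the «R» of the prose,
and `star_regularRep` is exactly the hypothesis `hρ` of T5SchurHilbert … T5SchurIsotypicSum.
Mathlib only.  Axioms: propext, Classical.choice, Quot.sound.
-/

namespace Summit.Ventures.HodgeRepro2.T5RegularRep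

open MeasureTheory ContinuousLinearMap
open scoped InnerProductSpace ENNReal

variable {G X : Type*} [Group G] [MulAction G X] [MeasurableSpace X] (μ : Measure X)
  [MeasurableConstSMul G X] [SMulInvariantMeasure G X μ]

/-- Composition with equal maps gives equal operators (the measure-preservation proofs are
irrelevant). -/
theorem compMeasurePreserving_congr {f f' : X → X} (h : f = f') (hf : MeasurePreserving f μ μ)
    (hf' : MeasurePreserving f' μ μ) :
    Lp.compMeasurePreserving (E := ℂ) (p := 2) f hf = Lp.compMeasurePreserving f' hf' := by
  subst h
  rfl

/-- The operator `f ↦ f ∘ (g⁻¹ • ·)` on `L²(X, μ)`, as a continuous linear map. -/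
noncomputable def regularOp (g : G) : Lp ℂ 2 μ →L[ℂ] Lp ℂ 2 μ :=
  (Lp.compMeasurePreservingₗᵢ ℂ (fun x => g⁻¹ • x) (measurePreserving_smul g⁻¹ μ)).toContinuousLinearMap

/-- `regularOp μ g f` is the composition of `f` with `x ↦ g⁻¹ • x`. -/
theorem regularOp_apply (g : G) (f : Lp ℂ 2 μ) :
    regularOp μ g f = Lp.compMeasurePreserving (fun x => g⁻¹ • x) (measurePreserving_smul g⁻¹ μ) f :=
  rfl

/-- `regularOp μ g` preserves the `L²`-norm. -/
theorem norm_regularOp_apply (g : G) (f : Lp ℂ 2 μ) : ‖regularOp μ g f‖ = ‖f‖ :=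
  Lp.norm_compMeasurePreserving f _

/-- `regularOp μ g` preserves the `L²`-inner product. -/
theorem inner_regularOp_apply (g : G) (f₁ f₂ : Lp ℂ 2 μ) :
    ⟪regularOp μ g f₁, regularOp μ g f₂⟫_ℂ = ⟪f₁, f₂⟫_ℂ :=
  (Lp.compMeasurePreservingₗᵢ ℂ (fun x => g⁻¹ • x) (measurePreserving_smul g⁻¹ μ)).inner_map_map f₁ f₂

/-- `regularOp μ 1 = 1`. -/
theorem regularOp_one : regularOp μ (1 : G) = 1 := by
  ext f
  rw [regularOp_apply, one_apply_eq_self,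
    compMeasurePreserving_congr μ (f := fun x => (1 : G)⁻¹ • x) (f' := id) (by
      funext x; simp) _ (MeasurePreserving.id μ), Lp.compMeasurePreserving_id_apply]

/-- `regularOp μ (g h) = regularOp μ g ∘ regularOp μ h` (the convention `f ↦ f ∘ (g⁻¹ • ·)` makes
this a homomorphism). -/
theorem regularOp_mul (g h : G) : regularOp μ (g * h) = regularOp μ g * regularOp μ h := by
  ext f
  rw [mul_apply_eq_comp, regularOp_apply, regularOp_apply, regularOp_apply,
    compMeasurePreserving_congr μ (f := fun x => (g * h)⁻¹ • x)
      (f' := (fun x => h⁻¹ • x) ∘ fun x => g⁻¹ • x) (by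
        funext x; simp [mul_smul]) _
      ((measurePreserving_smul h⁻¹ μ).comp (measurePreserving_smul g⁻¹ μ)),
    Lp.compMeasurePreserving_comp_apply f (measurePreserving_smul h⁻¹ μ)
      (measurePreserving_smul g⁻¹ μ)]

/-- **The regular representation** of `G` on `L²(X, μ)`: `(regularRep μ g) f = f ∘ (g⁻¹ • ·)`. -/
noncomputable def regularRep : G →* (Lp ℂ 2 μ →L[ℂ] Lp ℂ 2 μ) where
  toFun := regularOp μ
  map_one' := regularOp_one μ
  map_mul' := regularOp_mul μ

/-- `regularRep μ g f` is the composition of `f` with `x ↦ g⁻¹ • x`. -/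
theorem regularRep_apply (g : G) (f : Lp ℂ 2 μ) :
    regularRep μ g f = Lp.compMeasurePreserving (fun x => g⁻¹ • x) (measurePreserving_smul g⁻¹ μ) f :=
  rfl

/-- Almost everywhere, `(regularRep μ g f) x = f (g⁻¹ • x)`. -/
theorem coeFn_regularRep_apply (g : G) (f : Lp ℂ 2 μ) :
    regularRep μ g f =ᵐ[μ] f ∘ (fun x => g⁻¹ • x) :=
  Lp.coeFn_compMeasurePreserving f _

/-- `regularRep μ g` preserves the `L²`-norm. -/
theorem norm_regularRep_apply (g : G) (f : Lp ℂ 2 μ) : ‖regularRep μ g f‖ = ‖f‖ :=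
  norm_regularOp_apply μ g f

/-- `regularRep μ g` preserves the `L²`-inner product («R is unitary»). -/
theorem inner_regularRep_apply (g : G) (f₁ f₂ : Lp ℂ 2 μ) :
    ⟪regularRep μ g f₁, regularRep μ g f₂⟫_ℂ = ⟪f₁, f₂⟫_ℂ :=
  inner_regularOp_apply μ g f₁ f₂

/-- **Unitarity** in the convention of the p5 Schur files: `star (ρ g) = ρ g⁻¹`. -/
theorem star_regularRep (g : G) : star (regularRep μ g) = regularRep μ g⁻¹ := by
  rw [star_eq_adjoint]
  symm
  rw [eq_adjoint_iff]
  intro x y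
  rw [← inner_regularRep_apply μ g⁻¹ x (regularRep μ g y), ← mul_apply_eq_comp, ← map_mul,
    inv_mul_cancel, map_one, one_apply_eq_self]

section Continuity

variable [TopologicalSpace G] [TopologicalSpace X] [BorelSpace X] [R1Space X]
  [μ.InnerRegularCompactLTTop] [IsLocallyFiniteMeasure μ] [ContinuousInv G] [ContinuousSMul G X]

omit [MeasurableSpace X] [MeasurableConstSMul G X] [BorelSpace X] [R1Space X] in
/-- The map `g ↦ (x ↦ g⁻¹ • x)` is continuous into `C(X, X)` (compact-open topology). -/
theorem continuous_inv_smul_continuousMap :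
    Continuous fun g : G => (⟨fun x => g⁻¹ • x, by fun_prop⟩ : C(X, X)) :=
  ContinuousMap.continuous_of_continuous_uncurry _ (by
    show Continuous fun p : G × X => p.1⁻¹ • p.2
    fun_prop)

/-- **Strong continuity** of the regular representation: for every `f ∈ L²`, `g ↦ ρ g f` is
continuous. -/
theorem continuous_regularRep_apply (f : Lp ℂ 2 μ) : Continuous fun g : G => regularRep μ g f := by
  have hc := Lp.compMeasurePreserving_continuous μ μ ℂ (p := 2) (by simp)
  have hmap : Continuous fun g : G =>
      ((f, ⟨⟨fun x => g⁻¹ • x, by fun_prop⟩, measurePreserving_smul g⁻¹ μ⟩) :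
        Lp ℂ 2 μ × {φ : C(X, X) // MeasurePreserving φ μ μ}) :=
    continuous_const.prodMk ((continuous_inv_smul_continuousMap (G := G) (X := X)).subtype_mk _)
  exact hc.comp hmap

end Continuity

section Product

variable {G₁ G₂ Y : Type*} [Group G₁] [Group G₂] [MulAction (G₁ × G₂) Y] [MeasurableSpace Y]
  (ν : Measure Y) [MeasurableConstSMul (G₁ × G₂) Y] [SMulInvariantMeasure (G₁ × G₂) Y ν]

/-- For a product group `G₁ × G₂` acting on `(Y, ν)`, the operators of the two factors commute
(«G_∞ commutes with K_f ⊂ G(𝔸_f)»). -/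
theorem commute_regularRep_prod (g₁ : G₁) (g₂ : G₂) :
    Commute (regularRep ν ((g₁, 1) : G₁ × G₂)) (regularRep ν ((1, g₂) : G₁ × G₂)) := by
  rw [commute_iff_eq, ← map_mul, ← map_mul, Prod.mk_mul_mk, Prod.mk_mul_mk, mul_one, one_mul,
    mul_one, one_mul]

/-- **(A3) STEP 1, «L^{K_f} is G_∞-stable».**  The subspace of `L²(Y, ν)` fixed by a subgroup `K`
of the second factor is stable under the first factor. -/
theorem invariants_stable_prod (K : Subgroup G₂) (g₁ : G₁) (f : Lp ℂ 2 ν)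
    (hf : ∀ k ∈ K, regularRep ν ((1, k) : G₁ × G₂) f = f) (k : G₂) (hk : k ∈ K) :
    regularRep ν ((1, k) : G₁ × G₂) (regularRep ν ((g₁, 1) : G₁ × G₂) f) =
      regularRep ν ((g₁, 1) : G₁ × G₂) f := by
  rw [← mul_apply_eq_comp, ← (commute_regularRep_prod ν g₁ k).eq, mul_apply_eq_comp, hf k hk]

end Product

end Summit.Ventures.HodgeRepro2.T5RegularRep
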